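import Mathlib.AlgebraicGeometry.ProjectiveSpectrum.Basic
import Mathlib.AlgebraicGeometry.Morphisms.ClosedImmersion
import Mathlib.AlgebraicGeometry.Pullbacks
import Mathlib.Algebra.MvPolynomial.Equiv
import Summits.Ventures.HodgeRepro2.T6A2ProjSmooth
import Summits.Ventures.HodgeRepro2.T6A2WeilTensor

/-!
# T6A2PointProjective — the base point is projective — the display
`Hyp.Hartshorne1977_pointProjective` DISCHARGED in kernel

Cell pub-hodge-repro2, Tier 6 (README §10), seat t6-p2 (A2 owner; gen 13, custodial). The A2 display
`Hyp.Hartshorne1977_pointProjective : IsProjectiveOver (𝟙_ (SchemeOver ℂ))` (T6A2HypHost; Hartshorne II Prop. 2.5 (b)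
at `S = ℂ[x₀]`, `f = x₀`) is PROVED here from Mathlib: for `n = 0` the single chart `D₊(X₀)` of
`ℙ⁰_k = Proj k[X₀]` is everything (`Proj.iSup_basicOpen_eq_top` over the one-element index set), its coordinate
ring `(k[X₀]_{X₀})₀` is `k` (the chart identification `chartEquiv` of T6A2ProjChart with no coordinates left,
`MvPolynomial.isEmptyRingEquiv`), so `Spec k ⟶ ℙ⁰_k` (`Spec` of that identification followed by `Proj.awayι`) is
an open immersion with full range, hence an isomorphism (`isIso_of_isOpenImmersion_of_opensRange_eq_top`),
hence a closed immersion; it is a morphism over `Spec k` by `Proj.awayι_toSpecZero`. Consequently the host's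
named `Prop` `isSmoothProjective_unit ℂ` (Varieties.lean l. 137) HOLDS (`WeilInst.unit_of_display`), and the display
is DISCHARGED IN KERNEL — count-neutral (TARGET-T6 §3 counting convention, §7(j)). Mathlib + host-api only; no new
display; no `sorry`; standard axioms.
§8(d): uses an L-value-free non-vanishing device: NO.
Filed in Tier-6 WAVE 1 (2026-08-26) as p438405 (definition lane, ACCEPTED 10:40Z, commit af89bec2e20d); this v2 differs from the filed bytes in this module docstring only (the staged-record wording dropped).
-/

namespace Summit.Ventures.HodgeRepro2.T6.A2Surface

open MvPolynomial HomogeneousLocalization AlgebraicGeometry CategoryTheory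

attribute [local instance] MvPolynomial.gradedAlgebra

universe u

section PointChart

variable (k : Type u) [Field k]

/-- `ℙ⁰` has one variable `X₀` and no chart coordinates: the index set `{j : Fin 1 // j ≠ 0}` is empty -/
theorem isEmpty_chartIndex_zero : IsEmpty {j : Fin 1 // j ≠ 0} :=
  ⟨fun j => j.2 (Subsingleton.elim _ _)⟩

/-- the coordinate ring of the chart `D₊(X₀) ⊂ ℙ⁰_k` is `k` itself -/
noncomputable def pointChartEquiv : Away (homogeneousSubmodule (Fin 1) k) (X 0) ≃+* k :=
  (chartEquiv k (0 : Fin 1)).symm.trans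
    (@isEmptyRingEquiv k {j : Fin 1 // j ≠ 0} _ (isEmpty_chartIndex_zero))

/-- the chart identification inverts the structure map `k → (k[X₀]_{X₀})₀` -/
theorem pointChartEquiv_chartAlgebraMap (r : k) :
    pointChartEquiv k (chartAlgebraMap k (0 : Fin 1) r) = r := by
  haveI := isEmpty_chartIndex_zero
  have h : chartAlgebraMap k (0 : Fin 1) r =
      chartEquiv k (0 : Fin 1) (algebraMap k (MvPolynomial {j : Fin 1 // j ≠ 0} k) r) :=
    (DFunLike.congr_fun (chartEquiv_comp_algebraMap k (0 : Fin 1)) r).symm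
  rw [h, pointChartEquiv, RingEquiv.trans_apply, RingEquiv.symm_apply_apply, MvPolynomial.algebraMap_eq,
    isEmptyRingEquiv_eq_coeff_zero, coeff_zero_C]

/-- as ring maps: `k → (k[X₀]_{X₀})₀ → k` is the identity -/
theorem pointChartEquiv_comp_chartAlgebraMap :
    (pointChartEquiv k).toRingHom.comp (chartAlgebraMap k (0 : Fin 1)) = RingHom.id k :=
  RingHom.ext fun r => pointChartEquiv_chartAlgebraMap k r

/-- the single chart `D₊(X₀)` is all of `ℙ⁰_k` -/
theorem basicOpen_X_zero_eq_top :
    Proj.basicOpen (homogeneousSubmodule (Fin 1) k) (X 0) = ⊤ := by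
  have h := Proj.iSup_basicOpen_eq_top (homogeneousSubmodule (Fin 1) k) X
    (irrelevant_le_span_range_X k)
  rwa [iSup_unique] at h

end PointChart

section PointEmbedding

variable (k : Type u) [Field k]

/-- `Spec k ⟶ ℙ⁰_k`: the spectrum of the chart identification followed by the chart inclusion `D₊(X₀) ⊂ ℙ⁰_k` -/
noncomputable def pointToProj : Spec (CommRingCat.of k) ⟶ Proj (homogeneousSubmodule (Fin 1) k) :=
  Spec.map (CommRingCat.ofHom (pointChartEquiv k).toRingHom) ≫
    Proj.awayι (homogeneousSubmodule (Fin 1) k) (X 0) (X_mem_homogeneousSubmodule_one k 0) Nat.one_pos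

/-- `Spec` of the chart identification is an isomorphism -/
theorem isIso_Spec_map_pointChartEquiv :
    IsIso (Spec.map (CommRingCat.ofHom (pointChartEquiv k).toRingHom)) := by
  have : CommRingCat.ofHom (pointChartEquiv k).toRingHom = (pointChartEquiv k).toCommRingCatIso.hom := rfl
  rw [this]
  infer_instance

/-- `Spec k ⟶ ℙ⁰_k` is an open immersion -/
theorem isOpenImmersion_pointToProj : IsOpenImmersion (pointToProj k) := by
  haveI := isIso_Spec_map_pointChartEquiv k
  unfold pointToProj
  infer_instance

/-- `Spec k ⟶ ℙ⁰_k` is surjective: its range is the chart `D₊(X₀) = ℙ⁰_k` -/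
theorem opensRange_pointToProj :
    haveI := isOpenImmersion_pointToProj k
    (pointToProj k).opensRange = ⊤ := by
  haveI := isIso_Spec_map_pointChartEquiv k
  haveI := isOpenImmersion_pointToProj k
  show (Spec.map (CommRingCat.ofHom (pointChartEquiv k).toRingHom) ≫
    Proj.awayι (homogeneousSubmodule (Fin 1) k) (X 0) (X_mem_homogeneousSubmodule_one k 0)
      Nat.one_pos).opensRange = ⊤
  rw [Scheme.Hom.opensRange_comp_of_isIso, Proj.opensRange_awayι, basicOpen_X_zero_eq_top]

/-- `Spec k ⟶ ℙ⁰_k` is an isomorphism (a surjective open immersion) -/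
theorem isIso_pointToProj : IsIso (pointToProj k) := by
  haveI := isOpenImmersion_pointToProj k
  exact isIso_of_isOpenImmersion_of_opensRange_eq_top _ (opensRange_pointToProj k)

/-- `Spec k ⟶ ℙ⁰_k` is a closed immersion -/
theorem isClosedImmersion_pointToProj : IsClosedImmersion (pointToProj k) := by
  haveI := isIso_pointToProj k
  infer_instance

/-- `Spec k ⟶ ℙ⁰_k` is a morphism over `Spec k`: composed with the structure morphism of `ℙ⁰_k` in the host's
form (`Proj.toSpecZero 𝒜 ≫ Spec.map (algebraMap k (𝒜 0))`, Varieties.lean ll. 40–44) it is the identity -/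
theorem pointToProj_comp_projHom :
    pointToProj k ≫ (Proj.toSpecZero (homogeneousSubmodule (Fin 1) k) ≫
      Spec.map (CommRingCat.ofHom (algebraMap k (homogeneousSubmodule (Fin 1) k 0)))) =
      𝟙 (Spec (CommRingCat.of k)) := by
  rw [pointToProj, Category.assoc, Proj.awayι_toSpecZero_assoc, ← Spec.map_comp, ← Spec.map_comp,
    ← CommRingCat.ofHom_comp, ← CommRingCat.ofHom_comp]
  have h : (pointChartEquiv k).toRingHom.comp
      ((fromZeroRingHom (homogeneousSubmodule (Fin 1) k) (Submonoid.powers (X 0))).comp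
        (algebraMap k (homogeneousSubmodule (Fin 1) k 0))) = RingHom.id k :=
    pointChartEquiv_comp_chartAlgebraMap k
  rw [h, CommRingCat.ofHom_id, Spec.map_id]

end PointEmbedding

section Host

open HostAPI.Carriers.AlgebraicGeometry.Motives MonoidalCategory

/-- THE POINT IS PROJECTIVE: the base point `Spec ℂ = 𝟙_ (SchemeOver ℂ)` embeds as a closed immersion into
`ℙ⁰_ℂ = projectiveSpace 0 ℂ` over `ℂ` (the host's `IsProjectiveOver`). -/
theorem isProjectiveOver_unit : IsProjectiveOver (𝟙_ (SchemeOver ℂ)) := by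
  refine ⟨0, Over.homMk (pointToProj ℂ) ?_, ?_⟩
  · change pointToProj ℂ ≫ (Proj.toSpecZero (homogeneousSubmodule (Fin (0 + 1)) ℂ) ≫
      Spec.map (CommRingCat.ofHom (algebraMap ℂ (homogeneousSubmodule (Fin (0 + 1)) ℂ 0)))) =
      𝟙 (Spec (CommRingCat.of ℂ))
    exact pointToProj_comp_projHom ℂ
  · change IsClosedImmersion (pointToProj ℂ)
    exact isClosedImmersion_pointToProj ℂ

end Host

end Summit.Ventures.HodgeRepro2.T6.A2Surface

namespace Summit.Ventures.HodgeRepro2.T6.Hyp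

open HostAPI.Carriers.AlgebraicGeometry.Motives
open Summit.Ventures.HodgeRepro2.T6.A2Surface

/-- THE DISPLAY `Hartshorne1977_pointProjective` HOLDS — DISCHARGED IN KERNEL from Mathlib (count-neutral,
TARGET-T6 §3 / §7(j)): the base point is projective over `ℂ`. -/
theorem Hartshorne1977_pointProjective_holds : Hartshorne1977_pointProjective :=
  isProjectiveOver_unit

/-- the host's named `Prop` `isSmoothProjective_unit ℂ` (Varieties.lean l. 137) HOLDS: the base point is a smooth
projective geometrically irreducible variety of dimension `0` in the host's sense -/
theorem isSmoothProjective_unit_holds :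
    HostAPI.Carriers.AlgebraicGeometry.Motives.isSmoothProjective_unit ℂ :=
  Summit.Ventures.HodgeRepro2.T6.WeilInst.unit_of_display Hartshorne1977_pointProjective_holds

end Summit.Ventures.HodgeRepro2.T6.Hyp
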